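import Mathlib
import HarnessLib
import Summits.Langlands.Langlands.Theses.SkinnerWilesDefectOne

/-!
# Skinner–Wiles' propagation of pro-modularity over `Spec R_𝒟`: the order-theoretic skeleton

Route `SkinnerWilesDefectOne`, support item stmt-Langlands-14718
(`ProModularOfEisensteinSeed : EisensteinProModularSeed → ReducibleOrdinaryProModular` = Skinner–Wiles'
steps (I)+(III) at defect one GIVEN step (II)).  Step (III) is [SW, §4.3, Prop. 4.1]: "If `(F, 𝒟)` is
good, and (P1) and (P2) hold for `𝒟`, then every prime of `R_𝒟` is pro-modular."  Its proof is a
short argument on the poset `Spec R_𝒟` from four inputs —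
(up) pro-modularity ascends ([SW, §4.1, p. 62], PROVED in the tree: `IsProModularPrimeAt.of_le`);
(P1) below a NICE pro-modular prime every prime is pro-modular (the patching theorem, step (I));
(P2) SOME nice pro-modular prime exists (step (II) — in the route, the seed `EisensteinProModularSeed`
through the landed entrance `isProModularPrimeAt_ker_of_isPadicallyAutomorphic`);
(conn) Raynaud's connectivity [SW, Prop. 2.4 and Cor. A.2]: whenever the irreducible components are
split into two non-empty classes, two components from different classes meet along a "big" prime;
(supply) above a big prime there is a nice prime ([SW, p. 65]: "Such a `𝔭` always exists", the landed
nice-prime supply + "good ⟹ nice") —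
and this file proves that argument ONCE, abstractly, for any commutative ring and any predicates
`ProMod`, `Nice`, `Big` on `Spec R` (`proMod_of_propagation`), together with the intermediate
statements SW actually use (`proMod_of_le_of_nice`-type components, `forall_minimalPrimes_proMod`).
The engine line's stub S4 (`stub_steinbergLevelEngine`) is this theorem instantiated on the Steinberg
locus with `ProMod := IsProModularPrimeAt 𝓡 𝒰`; what remains there is exactly (P1), (conn), (supply).

References: C. M. Skinner, A. J. Wiles, *Residually reducible representations and modular forms*,
Publ. Math. IHÉS 89 (1999), §4.1 (p. 62), §4.3 (Prop. 4.1, pp. 64–66), Prop. 2.4, App. A (Cor. A.2).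
[SkinnerWiles1999]
-/

set_option linter.dupNamespace false -- project-wide option (lakefile weak.linter.dupNamespace); `Summit.Langlands.Langlands` is the mandated namespace

namespace Summit.Langlands.Langlands.Theorems

variable {R : Type*} [CommRing R]

/-- Every point of `Spec R` lies above a minimal prime (an irreducible component). [folklore] -/
theorem primeSpectrum_exists_minimalPrimes_le (𝔮 : PrimeSpectrum R) :
    ∃ C : PrimeSpectrum R, C.asIdeal ∈ minimalPrimes R ∧ C ≤ 𝔮 := by
  obtain ⟨p, hp, hle⟩ := Ideal.exists_minimalPrimes_le (I := (⊥ : Ideal R)) (J := 𝔮.asIdeal) bot_le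
  exact ⟨⟨p, hp.1.1⟩, hp, (PrimeSpectrum.asIdeal_le_asIdeal _ _).mp hle⟩

/-- **Step one of [SW, Prop. 4.1]: a component through a nice pro-modular prime is pro-modular** —
with (P1) every prime below the nice prime, in particular the component's minimal prime, is
pro-modular, and pro-modularity ascends from the minimal prime to the whole component.
[cite: SkinnerWiles1999, §4.3 proof of Prop. 4.1 (step one)] -/
theorem proMod_of_le_of_le_nice (ProMod Nice : PrimeSpectrum R → Prop)
    (up : ∀ 𝔮 𝔭 : PrimeSpectrum R, 𝔮 ≤ 𝔭 → ProMod 𝔮 → ProMod 𝔭)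
    (P1 : ∀ 𝔭 : PrimeSpectrum R, Nice 𝔭 → ProMod 𝔭 → ∀ 𝔮 : PrimeSpectrum R, 𝔮 ≤ 𝔭 → ProMod 𝔮)
    {C 𝔭 𝔮 : PrimeSpectrum R} (hC𝔭 : C ≤ 𝔭) (h𝔭 : Nice 𝔭) (h𝔭' : ProMod 𝔭) (hC𝔮 : C ≤ 𝔮) :
    ProMod 𝔮 :=
  up C 𝔮 hC𝔮 (P1 𝔭 h𝔭 h𝔭' C hC𝔭)

/-- **[SW, Prop. 4.1], abstract form: (up) + (P1) + (P2) + Raynaud connectivity + nice-prime supply ⟹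
every minimal prime is pro-modular.**  Let `S` be the set of pro-modular minimal primes.  By (P2) and
(P1) it is non-empty.  If some minimal prime were not pro-modular, connectivity gives minimal primes
`C₁ ∈ S`, `C₂ ∉ S` and a big prime `Q ⊇ C₁, C₂`; by the supply there is a nice `𝔭 ⊇ Q`; `𝔭` is
pro-modular (up from `C₁`), so by (P1) every prime below `𝔭` is — including `C₂`, contradiction.
[cite: SkinnerWiles1999, §4.3 proof of Prop. 4.1] -/
theorem forall_minimalPrimes_proMod (ProMod Nice Big : PrimeSpectrum R → Prop)
    (up : ∀ 𝔮 𝔭 : PrimeSpectrum R, 𝔮 ≤ 𝔭 → ProMod 𝔮 → ProMod 𝔭)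
    (P1 : ∀ 𝔭 : PrimeSpectrum R, Nice 𝔭 → ProMod 𝔭 → ∀ 𝔮 : PrimeSpectrum R, 𝔮 ≤ 𝔭 → ProMod 𝔮)
    (P2 : ∃ 𝔭 : PrimeSpectrum R, Nice 𝔭 ∧ ProMod 𝔭)
    (conn : ∀ S : Set (PrimeSpectrum R),
      (∃ C ∈ S, C.asIdeal ∈ minimalPrimes R) → (∃ C ∉ S, C.asIdeal ∈ minimalPrimes R) →
        ∃ C₁ ∈ S, ∃ C₂ ∉ S, C₁.asIdeal ∈ minimalPrimes R ∧ C₂.asIdeal ∈ minimalPrimes R ∧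
          ∃ Q : PrimeSpectrum R, C₁ ≤ Q ∧ C₂ ≤ Q ∧ Big Q)
    (supply : ∀ Q : PrimeSpectrum R, Big Q → ∃ 𝔭 : PrimeSpectrum R, Q ≤ 𝔭 ∧ Nice 𝔭) :
    ∀ C : PrimeSpectrum R, C.asIdeal ∈ minimalPrimes R → ProMod C := by
  -- `S` = the pro-modular primes; it contains a minimal prime (below the seed)
  by_contra hcon
  push Not at hcon
  obtain ⟨C₀, hC₀min, hC₀⟩ := hcon
  obtain ⟨𝔭₀, h𝔭₀, h𝔭₀'⟩ := P2
  obtain ⟨C₁', hC₁'min, hC₁'le⟩ := primeSpectrum_exists_minimalPrimes_le 𝔭₀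
  have hC₁' : ProMod C₁' := P1 𝔭₀ h𝔭₀ h𝔭₀' C₁' hC₁'le
  obtain ⟨C₁, hC₁, C₂, hC₂, -, -, Q, h₁, h₂, hQ⟩ :=
    conn {C | ProMod C} ⟨C₁', hC₁', hC₁'min⟩ ⟨C₀, hC₀, hC₀min⟩
  obtain ⟨𝔭, hQ𝔭, h𝔭⟩ := supply Q hQ
  have h𝔭' : ProMod 𝔭 := up C₁ 𝔭 (h₁.trans hQ𝔭) hC₁
  exact hC₂ (P1 𝔭 h𝔭 h𝔭' C₂ (h₂.trans hQ𝔭))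

/-- **[SW, Prop. 4.1]: every prime of `R_𝒟` is pro-modular**, abstract form (every prime lies above a
minimal one and pro-modularity ascends). [cite: SkinnerWiles1999, §4.3 Prop. 4.1] -/
theorem proMod_of_propagation (ProMod Nice Big : PrimeSpectrum R → Prop)
    (up : ∀ 𝔮 𝔭 : PrimeSpectrum R, 𝔮 ≤ 𝔭 → ProMod 𝔮 → ProMod 𝔭)
    (P1 : ∀ 𝔭 : PrimeSpectrum R, Nice 𝔭 → ProMod 𝔭 → ∀ 𝔮 : PrimeSpectrum R, 𝔮 ≤ 𝔭 → ProMod 𝔮)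
    (P2 : ∃ 𝔭 : PrimeSpectrum R, Nice 𝔭 ∧ ProMod 𝔭)
    (conn : ∀ S : Set (PrimeSpectrum R),
      (∃ C ∈ S, C.asIdeal ∈ minimalPrimes R) → (∃ C ∉ S, C.asIdeal ∈ minimalPrimes R) →
        ∃ C₁ ∈ S, ∃ C₂ ∉ S, C₁.asIdeal ∈ minimalPrimes R ∧ C₂.asIdeal ∈ minimalPrimes R ∧
          ∃ Q : PrimeSpectrum R, C₁ ≤ Q ∧ C₂ ≤ Q ∧ Big Q)
    (supply : ∀ Q : PrimeSpectrum R, Big Q → ∃ 𝔭 : PrimeSpectrum R, Q ≤ 𝔭 ∧ Nice 𝔭) :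
    ∀ 𝔮 : PrimeSpectrum R, ProMod 𝔮 := by
  intro 𝔮
  obtain ⟨C, hCmin, hC𝔮⟩ := primeSpectrum_exists_minimalPrimes_le 𝔮
  exact up C 𝔮 hC𝔮 (forall_minimalPrimes_proMod ProMod Nice Big up P1 P2 conn supply C hCmin)

/-- **The same inside a closed sub-locus `Z ⊆ Spec R`** (the form needed by stub S4 of line
`steinberg_hyperplane`, run on the Steinberg locus `Z_St`, and by [SW] on `Spec R_𝒟^{min}`): all
predicates and hypotheses relativised to `Z`, "minimal" meaning minimal IN `Z`; every point of `Z` lies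
above a `Z`-minimal one because `Z`, being closed, is the zero locus of an ideal whose minimal primes
are the `Z`-minimal points. [cite: SkinnerWiles1999, §4.3 Prop. 4.1] -/
theorem proMod_of_propagation_on (Z : Set (PrimeSpectrum R)) (hZ : IsClosed Z)
    (ProMod Nice Big : PrimeSpectrum R → Prop)
    (up : ∀ 𝔮 𝔭 : PrimeSpectrum R, 𝔮 ∈ Z → 𝔭 ∈ Z → 𝔮 ≤ 𝔭 → ProMod 𝔮 → ProMod 𝔭)
    (P1 : ∀ 𝔭 ∈ Z, Nice 𝔭 → ProMod 𝔭 → ∀ 𝔮 ∈ Z, 𝔮 ≤ 𝔭 → ProMod 𝔮)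
    (P2 : ∃ 𝔭 ∈ Z, Nice 𝔭 ∧ ProMod 𝔭)
    (conn : ∀ S : Set (PrimeSpectrum R),
      (∃ C ∈ S, C ∈ Z ∧ ∀ D ∈ Z, D ≤ C → D = C) → (∃ C ∉ S, C ∈ Z ∧ ∀ D ∈ Z, D ≤ C → D = C) →
        ∃ C₁ ∈ S, ∃ C₂ ∉ S, C₁ ∈ Z ∧ C₂ ∈ Z ∧ ∃ Q ∈ Z, C₁ ≤ Q ∧ C₂ ≤ Q ∧ Big Q)
    (supply : ∀ Q ∈ Z, Big Q → ∃ 𝔭 ∈ Z, Q ≤ 𝔭 ∧ Nice 𝔭) :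
    ∀ 𝔮 ∈ Z, ProMod 𝔮 := by
  -- `Z = V(J)`; every point of `Z` is above a `Z`-minimal point (a minimal prime of `J`)
  obtain ⟨J, hJ⟩ := (PrimeSpectrum.isClosed_iff_zeroLocus_ideal Z).mp hZ
  have hmem : ∀ 𝔮 : PrimeSpectrum R, 𝔮 ∈ Z ↔ J ≤ 𝔮.asIdeal := fun 𝔮 => by
    rw [hJ, PrimeSpectrum.mem_zeroLocus, SetLike.coe_subset_coe]
  have hmin : ∀ 𝔮 ∈ Z, ∃ C ∈ Z, (∀ D ∈ Z, D ≤ C → D = C) ∧ C ≤ 𝔮 := by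
    intro 𝔮 h𝔮
    obtain ⟨q, hq, hle⟩ := Ideal.exists_minimalPrimes_le ((hmem 𝔮).mp h𝔮)
    refine ⟨⟨q, hq.1.1⟩, (hmem _).mpr hq.1.2, fun D hD hDC => ?_, (PrimeSpectrum.asIdeal_le_asIdeal _ _).mp hle⟩
    apply PrimeSpectrum.ext
    exact le_antisymm ((PrimeSpectrum.asIdeal_le_asIdeal _ _).mpr hDC)
      (hq.2 ⟨D.isPrime, (hmem D).mp hD⟩ ((PrimeSpectrum.asIdeal_le_asIdeal _ _).mpr hDC))
  -- all `Z`-minimal points are pro-modular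
  have hall : ∀ C ∈ Z, (∀ D ∈ Z, D ≤ C → D = C) → ProMod C := by
    by_contra hcon
    push Not at hcon
    obtain ⟨C₀, hC₀Z, hC₀min, hC₀⟩ := hcon
    obtain ⟨𝔭₀, h𝔭₀Z, h𝔭₀, h𝔭₀'⟩ := P2
    obtain ⟨C₁', hC₁'Z, hC₁'min, hC₁'le⟩ := hmin 𝔭₀ h𝔭₀Z
    have hC₁' : ProMod C₁' := P1 𝔭₀ h𝔭₀Z h𝔭₀ h𝔭₀' C₁' hC₁'Z hC₁'le
    obtain ⟨C₁, hC₁, C₂, hC₂, hC₁Z, hC₂Z, Q, hQZ, h₁, h₂, hQ⟩ :=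
      conn {C | ProMod C} ⟨C₁', hC₁', hC₁'Z, hC₁'min⟩ ⟨C₀, hC₀, hC₀Z, hC₀min⟩
    obtain ⟨𝔭, h𝔭Z, hQ𝔭, h𝔭⟩ := supply Q hQZ hQ
    have h𝔭' : ProMod 𝔭 := up C₁ 𝔭 hC₁Z h𝔭Z (h₁.trans hQ𝔭) hC₁
    exact hC₂ (P1 𝔭 h𝔭Z h𝔭 h𝔭' C₂ hC₂Z (h₂.trans hQ𝔭))
  intro 𝔮 h𝔮
  obtain ⟨C, hCZ, hCmin, hC𝔮⟩ := hmin 𝔮 h𝔮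
  exact up C 𝔮 hCZ h𝔮 hC𝔮 (hall C hCZ hCmin)

end Summit.Langlands.Langlands.Theorems
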